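import Literature.IUT.HodgeArakelov.MonoThetaProjectiveProp16EllipticRefGenuine
import Literature.AnabelianGeometry.AbsoluteAnabelian.AbsTopII.EllipticCuspidalizationContent

/-!
# [IUTchII] Prop. 1.6 (ii): the successor predicate STRENGTHENED — the [AbsTopII] Cor. 3.3 (iii) record of clause
# (R2) must REALIZE THE PRINTED CHAIN of `N² − 1` de-cuspidalizations (statement-only successor, v2 of `RefIsElliptic`)

S. Mochizuki, *Inter-universal Teichmüller Theory II*, kurims manuscript (Dec. 2020), §1, Prop. 1.6 (ii) p. 31
l. 34–41: "(Elliptic Cuspidalizations) Let `N` be a positive integer. Then there exists a functorial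
group-theoretic algorithm [cf. [AbsTopII], Corollary 3.3, (iii); [AbsTopII], Remark 3.3.3] `Π ↦ {Π_{U_N}(Π) ↠ Π}`
… such that when `Π = Π^tp_{X̲̲_k}`, the surjection `Π_{U_N}(Π) ↠ Π` may be naturally identified with a certain
surjection — i.e., “elliptic cuspidalization” — that arises from a certain open immersion determined by the
`N`-torsion points of a once-punctured elliptic curve that forms a double covering of `C_k`"
[claim: Mochizuki2012, status: disputed] (IUTchII §1 Prop 1.6 (ii), kurims p.31). S. Mochizuki, *Topics in
Absolute Anabelian Geometry II*, Ex. 3.2 (i)(ii) pp. 66–67 (the chain `X ⇝ V ⇝ D ⇝ U ⇝ U_{N²−1} ⇝ ⋯ ⇝ U_1 = D`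
of `N² − 1` de-cuspidalization operations at the `N`-torsion points), Cor. 3.3 (iii)(a) p. 68 ("a `Π`-chain … with
associated type-chain `⋏, ⋎, ⋏, •, …, •, ⋏, ⋎` … such that the natural surjection `Π_U ↠ Π_D` may be recovered from
the chain of •'s terminating at the third to last group"), (c) p. 69 [cite: MochizukiAbsTopII2013, Cor 3.3 (iii) p.68];
[AbsTopI] Lem. 4.5 (v) / Def. 4.2 (iii) (cuspidal decomposition groups; condition (3_Π))
[cite: MochizukiAbsTopI2012, Def 4.2 (iii) p.49]; [SemiAnbd] §6 pp. 69–74 (tempered `Π^temp`, profinite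
completion, cusps, decomposition/inertia groups) [cite: MochizukiSemiAnbd2006, §6 pp.69-74].

STATEMENT-ONLY successor (one `Prop`-valued predicate `IsCuspidalDataOf`, one `Prop`-structure
`RefIsEllipticChain`, one structure `GenuineChain`; NO proof here, NO named fact; the frozen files
`MonoThetaProjective.lean` p407497, `…Prop16EllipticRef.lean` p437894, `…Prop16EllipticRefGenuine.lean` p439458
are byte-untouched) of the abc-iut cell, seat abc-iut-L6-t2 (gen 3), row «REFISELLIPTIC-R2-CHAIN» of
abc-iut-L6-lead §F v1.19at (2) / §F v1.19at-ter (1), for the DAG node **IUTchII:Prop1.6(ii)** (layer L6, OUTSIDE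
the [IUTchIII] Cor. 3.12 cone) — FREEZE-L6 post-freeze disclosure X-L6t2-RC1 (reading (ii): «successor predicate
strengthening clause (R2)»).

WHY (RQ7 finding A21g10-F1, abc-iut-L6-t21 gen 10, kernel witness p447116
`MonoThetaProjectiveProp16EllipticRefIdentityWitness.lean`): as typed, clause (R2) of abc-iut-w5-d030's
`EllipticCuspidalization.RefIsElliptic` pins the level `N` only to the LABEL field of abc-iut-L4-t6's OUTPUT record
`AbsTopII.EllipticCuspidalization E` ([AbsTopII] Cor. 3.3 (iii), "content-light as typed", F-f067-1), so the
IDENTITY output (`U := X`, no cusp removed, `Π_{U_X} ↠ Π'` the identity, a record WITHOUT cusps) satisfies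
`RefIsElliptic` / inhabits `Genuine` for every `N`.  Print's "elliptic cuspidalization … determined by the
`N`-torsion points" lives in the L4 CONTENT conjunct `AbsTopII.EllipticCuspidalization.RealizesChain` (the record's
`Π_U ↠ Π_D` IS the composite of the `N² − 1` de-cuspidalization steps • of a genuine `Π`-chain of the printed type,
each killing a NONTRIVIAL cuspidal decomposition group — condition (3_Π)).

WHAT IS TYPED (the repair asked for by the lead, L6-t21's suggested shape):
* `EllipticCuspidalization.IsCuspidalDataOf X iX CD` — "the cuspidal data `CD` on `E ≅ Π̂_X` IS the cuspidal data of
  the tempered curve `X`": every recorded cusp's decomposition group is, up to `Π̂_X`-conjugacy, the image under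
  `iX` of the closure in `Π̂_X` of `D_x ⊆ Π^tp_X` for a CUSP `x` of `X` ([SemiAnbd] §6 p. 71; [AbsTopI] Lem. 4.5 (v)),
  and every cusp of `X` is so recorded;
* **`EllipticCuspidalization.RefIsEllipticChain K X U eX eU`** `extends RefIsElliptic K X U eX eU` by ONE field
  (R2′) `ellipticChain`: the data `(E, iX, C, iU)` of (R2) — SAME three clauses: `C.N = N`, `iX` matches `Δ̂_X`, the
  completion square over `Π^tp_U ↠ Π^tp_X` commutes — AND cuspidal data `CD` of `Π̂_X` (`IsCuspidalDataOf`) with the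
  slimness inputs of [AbsTopI] Def. 4.2 (`Π̂_X`, `Δ̂_X` slim, `Δ̂_X ≠ 1` — true of hyperbolic curves, to be supplied
  by the inhabiting model) such that **`C.RealizesChain C.Sigma CD hP hΔ hne`**: the record REALIZES the printed
  chain of Cor. 3.3 (iii)(a) relative to the cusps of `X`;
* **`EllipticCuspidalization.GenuineChain S N P X U eX`** `extends Genuine S N P X U eX` by the proof field
  `refIsEllipticChain` — the decl-for-decl replacement of record (a consumer reads the same fields through
  `toGenuine`, now with the chain content).
PROOF-ONLY companion `MonoThetaProjectiveProp16EllipticRefChainProofs.lean` (same seat): the re-derivations over the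
strengthened predicate (`toRefIsElliptic`, `range_aug_comp_refHom`, `exists_aug_refHom_eq`, `exists_level`, …,
`transport`) and the NON-DEGENERACY theorems — `not_refIsEllipticChain_of_completesToIso` (for `N ≥ 2` no output
whose tempered reference surjection completes to an isomorphism of profinite groups satisfies (R2′); L4 input:
this seat's `AbsTopII.EllipticCuspidalization.RealizesChain.proj_not_injective_of_two_le`,
`AbsTopII/EllipticCuspidalizationChainNonDegeneracy.lean`) and `IdentityWitness.not_refIsEllipticChain_idOutput`
(abc-iut-L6-t21's identity output p447116 FAILS (R2′) for every `N ≥ 2`, every `X`, `eX`).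

HONEST SCOPE: a PREDICATE and a STRUCTURE over interface data; nothing is inhabited or asserted here; inhabiting
them at the [EtTh] model needs the tempered fundamental group of `U_X`, a genuine [AbsTopII] Cor. 3.3 (iii) record
realizing the chain (abc-iut-L4-t4 / abc-iut-L4-t6 `EllipticDatumModel.Cor_3_3_iii″` / `IsCanonicalOutput′` suppliers) and the
slimness of `Π̂_X`, `Δ̂_X` — MERGE debts (MERGE-MAP rows 92/141) unchanged.  For `N = 1` print's `U_1 = X̲̲` and the
chain has no • step (the identity IS then admissible: `RealizesChain.projU_injective_of_sq_sub_one_eq_zero`).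
Nothing here takes a side on [IUTchIII] Cor. 3.12; typed ≠ proved; constructed ≠ the paper's reconstruction.
-/

open Topology
open scoped Pointwise

universe u

namespace Literature.IUT.HodgeArakelov

open Literature.AnabelianGeometry.SemiGraphs (TemperedCurve)
open Literature.AnabelianGeometry.AbsoluteAnabelian (FundamentalExtension)
open Literature.AnabelianGeometry.AbsoluteAnabelian.FundamentalExtension (CuspidalData)
open Literature.AlgebraicGeometry.Frobenioids (IsSlimGroup)

namespace EllipticCuspidalization

variable {S : ThetaSetting.{u}} {N : ℕ+} {P : TopGroup.{u}} {p : ℕ} [Fact p.Prime]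

/-! ## "The cuspidal data of `Π̂_X`" relative to a tempered curve `X` and an identification `iX : Π̂_X ≃ E` -/

/-- **The cuspidal data `CD` on `E ≅ Π̂_X` IS THE CUSPIDAL DATA OF THE TEMPERED CURVE `X`** ([SemiAnbd] §6 p. 71:
the cusps of `X̄_K` with their decomposition groups `D_x ⊆ Π^temp_{X_K}`, "well-defined up to conjugation", whose
closures in the profinite completion are the profinite cuspidal decomposition groups of [AbsTopI] Lem. 4.5 (v)):
(1) every cusp recorded by `CD` is a cusp of `X` — its representative decomposition group is, up to `Π̂_X`-conjugacy
(read in `E` through `iX`), the image under `iX` of the closure of `toHat(D_x)` for some cusp `x` of `X`; (2) every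
cusp `x` of `X` is recorded by `CD` in this way. A `Prop`; nothing asserted.
[cite: MochizukiSemiAnbd2006, §6 p.71] -/
def IsCuspidalDataOf (X : TemperedCurve p) {E : FundamentalExtension.{0}} (iX : X.PiHat ≃ₜ* E.arith)
    (CD : CuspidalData E) : Prop :=
  (∀ c : CD.Cusp, ∃ x : X.Pt, X.IsCusp x ∧ ∃ g : E.arith,
      CD.Dcusp c = MulAut.conj g •
        ((X.decomp x).map X.toHat.toMonoidHom).topologicalClosure.map iX.toMulEquiv.toMonoidHom) ∧
    ∀ x : X.Pt, X.IsCusp x → ∃ (c : CD.Cusp) (g : E.arith),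
      CD.Dcusp c = MulAut.conj g •
        ((X.decomp x).map X.toHat.toMonoidHom).topologicalClosure.map iX.toMulEquiv.toMonoidHom

/-! ## The strengthened successor predicate -/

section Ref

variable (K : EllipticCuspidalization S N P) (X U : TemperedCurve p)
  (eX : X.PiTemp ≃ₜ* S.PiX) (eU : U.PiTemp ≃ₜ* K.PiURef)

/-- **THE SUCCESSOR PREDICATE of IUTchII:Prop1.6(ii), v2 (clause (R2) WITH THE CHAIN CONTENT).**  `RefIsElliptic`
(abc-iut-w5-d030: (R0) `Π = Π^tp_{X̲̲_k}`; (R1) the tempered `DLoc`-kernel reading with [AbsTopII] Cor. 3.3 (iii)(c);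
(R2) the profinite completion is an [AbsTopII] Cor. 3.3 (iii) record `C` of level `N`) EXTENDED by (R2′): there are
such data `(E, iX, C, iU)` — `C.N = N`, `iX` matching `Δ̂_X`, the completion square
`Π̂_U → Π̂_X` over `Π^tp_U ↠ Π^tp_X` commuting — TOGETHER WITH cuspidal data `CD` of `Π̂_X` that IS the cuspidal data of
`X` (`IsCuspidalDataOf`) and the slimness inputs of [AbsTopI] Def. 4.2, such that the record **realizes the printed
chain** of Cor. 3.3 (iii)(a) ("a `Π`-chain … of type `⋏, ⋎, ⋏, •, …, •, ⋏, ⋎` … such that the natural surjection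
`Π_U ↠ Π_D` may be recovered from the chain of •'s", `N² − 1` de-cuspidalizations — Ex. 3.2 (ii): "determined by
the `N`-torsion points"): abc-iut-L4-t6's `AbsTopII.EllipticCuspidalization.RealizesChain C.Sigma CD hP hΔ hne`.
So the level `N` is load-bearing THROUGH THE CHAIN, and for `N ≥ 2` the reference surjection cannot be (complete to)
an isomorphism (proof companion). A `Prop`; never asserted; to be inhabited at genuine models and consumed BY NAME.
[cite: MochizukiAbsTopII2013, Cor 3.3 (iii)(a) p.68]
[claim: Mochizuki2012, status: disputed] (IUTchII §1 Prop 1.6 (ii), kurims p.31) -/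
structure RefIsEllipticChain : Prop extends K.RefIsElliptic X U eX eU where
  /-- (R2′) ELLIPTIC OF LEVEL `N` WITH THE CHAIN CONTENT: an [AbsTopII] Cor. 3.3 (iii) record `C` of level `N` over
  an extension `E ≅ Π̂_X` (matching `Δ̂_X`), identified with the completion of `Π^tp_U ↠ Π^tp_X`, which REALIZES
  THE PRINTED CHAIN relative to cuspidal data that IS the cuspidal data of `X` -/
  ellipticChain : ∃ (E : FundamentalExtension.{0}) (iX : X.PiHat ≃ₜ* E.arith)
      (C : Literature.AnabelianGeometry.AbsoluteAnabelian.AbsTopII.EllipticCuspidalization E)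
      (iU : U.PiHat ≃ₜ* C.cuspUX.arith),
    C.N = (N : ℕ) ∧ (∀ z : X.PiHat, iX z ∈ E.geom ↔ z ∈ X.DeltaHat) ∧
      (∀ y : U.PiTemp, C.proj.arith (iU (U.toHat y)) = iX (X.toHat (K.refHom X U eX eU y))) ∧
      ∃ (CD : CuspidalData E) (hP : IsSlimGroup E.arith) (hΔ : IsSlimGroup E.geom) (hne : E.geom ≠ ⊥),
        IsCuspidalDataOf X iX CD ∧ C.RealizesChain C.Sigma CD hP hΔ hne

end Ref

end EllipticCuspidalization

/-! ## The genuine output structure, v2 -/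

/-- **IUTchII:Prop1.6(ii), GENUINE OUTPUT v2** ("Elliptic Cuspidalizations", kurims p. 31): abc-iut-w5-d030's
`EllipticCuspidalization.Genuine S N P X U eX` (the frozen output extended decl-for-decl on its reference side by
`eU : Π^tp_U ≃ₜ* PiURef` and `RefIsElliptic`) FURTHER constrained by the chain content (R2′): the proof field
`refIsEllipticChain`. A consumer that took `G : Genuine …` takes `G : GenuineChain …` and reads the same fields through
`G.toGenuine`. A structure over the tree's interfaces; never asserted to be inhabited.
[claim: Mochizuki2012, status: disputed] (IUTchII §1 Prop 1.6 (ii), kurims p.31) -/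
structure EllipticCuspidalization.GenuineChain (S : ThetaSetting.{u}) (N : ℕ+) (P : TopGroup.{u})
    {p : ℕ} [Fact p.Prime] (X U : TemperedCurve p) (eX : X.PiTemp ≃ₜ* S.PiX)
    extends EllipticCuspidalization.Genuine S N P X U eX where
  /-- the reference surjection IS the elliptic cuspidalisation of level `N` AND its [AbsTopII] Cor. 3.3 (iii) record
  realizes the printed chain relative to the cusps of `X` (v2 successor predicate) -/
  refIsEllipticChain : toEllipticCuspidalization.RefIsEllipticChain X U eX eU

end Literature.IUT.HodgeArakelov
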